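import Summits.Ventures.QEC.Census.RefinedIPCertificateGridValid
import Literature.InformationTheory.QuantumCodes.RefinedLPBoundEvenSubcode
import HarnessLib

/-!
# Certificates for CRSS's refined LP of the pair `(C, C′)` (even-subcode block): checker, soundness, assembly

Venture QEC (cell `qec`, LADDER-QEC rung X1; row 06). `Literature/…/RefinedLPBoundEvenSubcode.lean` types CRSS's refined
linear program [CalderbankEtAl1998, §7 (ii)] for the PAIR `(C, C′)` — the refined distributions `R, R′` of `C, C⊥` AND
`R″` of `(C′)⊥` (`C′` the even subcode of Thm. 21, eq. (21) `C⊥ ⊆ (C′)⊥`), the block of `R″` being literally a second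
instance of `CRSSRefinedSystem` at `(n, k + e, 1, w₀)` on `(evenPart A, W, evenPart₃ R, R″)` — and PROVES it for every
additive code with a codeword of even weight `w₀` (`CRSSRefinedPairFeasible`). This file is OUR side, the pair analogue
of `RefinedIPCertificateGridValid.lean`:

* `RLeafP` — a grid leaf `RLeafG` for the block `(R, R′)` (all its families unchanged) plus the families of the second
  block: `lamW` (marginal rows `Σ_{a+b+c=j} R″ = W_j`), `mus2` (the refined identity of `(C′, (C′)⊥)` on the canonical
  grid, tensor-factored tables exactly as for block 1), `zRpp`, `tRpp` (zero / translation rows of `R″`), `kap2` (the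
  link rows `R″ − R′ ≥ 0`); `rleafOKP` checks the valid classes only (even `c`, `b + c ≤ w₀`; the three unknowns vanish
  elsewhere), `RTreeP` adds the integer splits of `RSplit` (on `A, B, W, R, R′`);
* the row algebra used by weak duality (marginal rows, translation rows, and the expansion of the combined coefficients
  into the row families); soundness and the two-stage assembly are in `RefinedPairCertificateSound.lean`.

HONEST FRAMING: nonexistence only; nothing here certifies a distance; per-cell certificates are DATA files
`Census/IPBounds/…`. References: [CalderbankEtAl1998, §7 Thm. 21 and (ii)–(iii) (printed pp. 26–28)];
[MacWilliamsSloane1977, Ch. 17 §4 Thm. 20] (dual vectors as certificates).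
-/

namespace Summit.Ventures.QEC.Census

open Finset Literature.InformationTheory.QuantumCodes

/-! ### 1. Pair leaves and trees -/

/-- A **pair leaf**: a grid leaf for the block `(R, R′)` plus multipliers for the rows of the even-subcode block
`R″`. Column: definition (ours). [cite: MacWilliamsSloane1977, Ch. 17 §4 Thm. 20] -/
structure RLeafP where
  /-- the block-1 families (base rows, marginals, grid identity, zero / translation / containment rows, unit rows,
  split multipliers) — exactly an `RLeafG` -/
  G : RLeafG
  /-- `λ″_j`: multipliers of the marginal rows `Σ_{a+b+c=j} R″ = W_j` -/
  lamW : List ℤ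
  /-- identity multipliers `μ″_{ij}` of the refined identity of `(C′, (C′)⊥)` on the canonical grid -/
  mus2 : List (List ℤ)
  /-- zero-row multipliers for `R″` (`c` odd or `b + c > w₀`) -/
  zRpp : List (List (List ℤ))
  /-- translation-row multipliers for `R″` -/
  tRpp : List (List (List ℤ))
  /-- multipliers (`≥ 0`) of the link rows `R″(a,b,c) − R′(a,b,c) ≥ 0` -/
  kap2 : List (List (List ℤ))

/-- A **pair certificate**: pair leaves under integer splits on `(A, B, W, R, R′)`. Column: definition (ours).
[cite: MacWilliamsSloane1977, Ch. 17 §4 Thm. 20] -/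
inductive RTreeP where
  /-- a pair leaf -/
  | leaf (L : RLeafP) : RTreeP
  /-- split on an integer linear form `≤ v ∨ ≥ v + 1` -/
  | split (ca cb cw : List ℤ) (cr crp : List (List (List ℤ))) (v : ℤ) (le ge : RTreeP) : RTreeP

section Check

variable (n k d e w₀ : ℕ)

/-- Combined coefficient of `W_j` (pair leaf): the block-1 coefficient minus `λ″_j`. [cite: MacWilliamsSloane1977, Ch. 17 §4 Thm. 20] -/
def coefWP (path : List RSplit) (L : RLeafP) (j : ℕ) : ℤ :=
  coefWG n k d e path L.G j - L.lamW.getD j 0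

/-- Combined coefficient of `R(a,b,c)` (pair leaf): the block-1 coefficient, minus the table `TT2` of the second
identity on the EVEN-weight classes (`R_{C′} = evenPart₃ R`). [cite: MacWilliamsSloane1977, Ch. 17 §4 Thm. 20] -/
def coefRP (TT TT2 : List (List (List ℤ))) (path : List RSplit) (L : RLeafP) (a b c : ℕ) : ℤ :=
  coefRG w₀ TT path L.G a b c + (if b + c ≤ w₀ ∧ Even (a + b + c) then -get3 TT2 a b c else 0)

/-- Combined coefficient of `R′(a,b,c)` (pair leaf): the block-1 coefficient minus the link multiplier.
[cite: MacWilliamsSloane1977, Ch. 17 §4 Thm. 20] -/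
def coefRpP (TP : List (List (List ℤ))) (path : List RSplit) (L : RLeafP) (a b c : ℕ) : ℤ :=
  coefRpG n k w₀ TP path L.G a b c - get3 L.kap2 a b c

/-- Combined coefficient of `R″(a,b,c)`: marginal `λ″_{a+b+c}`, the second identity's table `TP2` times
`|C′| = 2^{n−k−e}`, translation, zero and link rows. [cite: MacWilliamsSloane1977, Ch. 17 §4 Thm. 20] -/
def coefRppP (TP2 : List (List (List ℤ))) (L : RLeafP) (a b c : ℕ) : ℤ :=
  (if b + c ≤ w₀ then
      L.lamW.getD (a + b + c) 0 + (2 : ℤ) ^ (n - (k + e)) * get3 TP2 a b c +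
        (get3 L.tRpp a b c - get3 L.tRpp a (w₀ - b - c) c)
    else 0) +
  (if Odd c ∨ w₀ < b + c then get3 L.zRpp a b c else 0) + get3 L.kap2 a b c

/-- **The pair leaf check**: the four grid tables (two per block) are computed once; admissible signs; every combined
coefficient of `A_j, B_j, W_j` and — on the valid classes — of `R, R′, R″` is `≤ 0`, link multipliers `≥ 0` there;
combined right-hand side `> 0`. Column: definition (ours). [cite: MacWilliamsSloane1977, Ch. 17 §4 Thm. 20] -/
def rleafOKP (path : List RSplit) (L : RLeafP) : Bool :=
  let TP := gridTabF (n - w₀) w₀ (gridX (n - w₀)) (gridY w₀) L.G.mus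
  let TT := gridTabF (n - w₀) w₀ ((gridX (n - w₀)).map tX) ((gridY w₀).map tY) L.G.mus
  let TP2 := gridTabF (n - w₀) w₀ (gridX (n - w₀)) (gridY w₀) L.mus2
  let TT2 := gridTabF (n - w₀) w₀ ((gridX (n - w₀)).map tX) ((gridY w₀).map tY) L.mus2
  decide (w₀ ≤ n) && signsOK (baseRows n k d e) L.G.base && splitSignsOK path L.G.smult &&
  ((List.range (n + 1)).all fun j =>
    decide (coefAG n k d e path L.G j ≤ 0) && decide (coefBG n k d e path L.G j ≤ 0) &&
      decide (coefWP n k d e path L j ≤ 0)) &&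
  ((List.range (n - w₀ + 1)).all fun a => (List.range (w₀ + 1)).all fun b => (List.range (w₀ + 1)).all fun c =>
    (decide (Odd c) || decide (w₀ < b + c)) ||
    ((!(decide (d ≤ a + b + c)) || decide (0 ≤ get3 L.G.kap a b c)) && decide (0 ≤ get3 L.kap2 a b c) &&
      decide (coefRP w₀ TT TT2 path L a b c ≤ 0) && decide (coefRpP n k w₀ TP path L a b c ≤ 0) &&
      decide (coefRppP n k e w₀ TP2 L a b c ≤ 0))) &&
  decide (0 < leafRhsG n k d e path L.G)

/-- The pair tree checker (splits as in `RTreeG`). Column: definition (ours). [cite: MacWilliamsSloane1977, Ch. 17 §4 Thm. 20] -/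
def RTreeP.checkPathP : RTreeP → List RSplit → Bool
  | .leaf L, path => rleafOKP n k d e w₀ path L
  | .split ca cb cw cr crp v le ge, path =>
    le.checkPathP (path ++ [⟨ca, cb, cw, cr, crp, v, false⟩]) && ge.checkPathP (path ++ [⟨ca, cb, cw, cr, crp, v, true⟩])

/-- The pair checker for `CRSSRefinedPairFeasible n k d w₀` in parity branch `e`. Column: definition (ours).
[cite: CalderbankEtAl1998, §7 (ii)] -/
def RTreeP.checkP (t : RTreeP) : Bool := t.checkPathP n k d e w₀ []

end Check

/-! ### 2. Row algebra for weak duality -/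

section RowAlgebra

variable {n k d e w₀ : ℕ} {A B W : ℕ → ℕ} {R Rp Rpp : ℕ → ℕ → ℕ → ℕ}

/-- Marginal rows regrouped by unknown: `boxSum([tri]·λ_{a+b+c}·X) = Σ_j λ_j T_j` when the triangle marginals of
`X` are the `T_j`. [cite: MacWilliamsSloane1977, Ch. 17 §4 Thm. 20] -/
theorem boxSum_marg_eq (hwn : w₀ ≤ n) (lam : List ℤ) (X : ℕ → ℕ → ℕ → ℕ) (T : ℕ → ℕ)
    (hT : ∀ j, j ≤ n → boxSum n w₀ (fun a b c => if b + c ≤ w₀ ∧ a + b + c = j then (X a b c : ℤ) else 0) = T j) :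
    boxSum n w₀ (fun a b c => (if b + c ≤ w₀ then lam.getD (a + b + c) 0 else 0) * (X a b c : ℤ)) =
      ∑ j ∈ range (n + 1), lam.getD j 0 * (T j : ℤ) := by
  calc boxSum n w₀ (fun a b c => (if b + c ≤ w₀ then lam.getD (a + b + c) 0 else 0) * (X a b c : ℤ))
      = boxSum n w₀ (fun a b c => ∑ j ∈ range (n + 1),
          lam.getD j 0 * (if b + c ≤ w₀ ∧ a + b + c = j then (X a b c : ℤ) else 0)) := by
        unfold boxSum
        refine Finset.sum_congr rfl fun a ha => Finset.sum_congr rfl fun b _ => Finset.sum_congr rfl fun c _ => ?_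
        beta_reduce
        by_cases htri : b + c ≤ w₀
        · have hwt : a + b + c ∈ range (n + 1) := mem_range.2 (by have := mem_range.1 ha; omega)
          simp only [htri, ↓reduceIte, true_and, mul_ite, mul_zero]
          rw [Finset.sum_ite_eq, if_pos hwt]
        · simp [htri]
    _ = ∑ j ∈ range (n + 1), lam.getD j 0 *
          boxSum n w₀ (fun a b c => if b + c ≤ w₀ ∧ a + b + c = j then (X a b c : ℤ) else 0) := by
        rw [boxSum_finset_sum]
        exact Finset.sum_congr rfl fun j _ => boxSum_mul n w₀ _ _
    _ = ∑ j ∈ range (n + 1), lam.getD j 0 * (T j : ℤ) :=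
        Finset.sum_congr rfl fun j hj => by rw [hT j (Nat.lt_succ_iff.1 (mem_range.1 hj))]

/-- Translation rows regrouped by unknown vanish on a translation-symmetric `X`:
`boxSum([tri]·(t(a,b,c) − t(a,w₀−b−c,c))·X) = 0`. [cite: CalderbankEtAl1998, §7 (ii) (translation by u₀)] -/
theorem boxSum_transRow_eq_zero (tX : List (List (List ℤ))) (X : ℕ → ℕ → ℕ → ℕ)
    (hX : ∀ a b c, b + c ≤ w₀ → X a b c = X a (w₀ - b - c) c) :
    boxSum n w₀ (fun a b c =>
      (if b + c ≤ w₀ then get3 tX a b c - get3 tX a (w₀ - b - c) c else 0) * (X a b c : ℤ)) = 0 := by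
  have e1 : boxSum n w₀ (fun a b c => if b + c ≤ w₀ then get3 tX a b c * (X a (w₀ - b - c) c : ℤ) else 0) =
      boxSum n w₀ (fun a b c => if b + c ≤ w₀ then get3 tX a (w₀ - b - c) c * (X a b c : ℤ) else 0) :=
    boxSum_translate n w₀ (fun a b c => get3 tX a b c) (fun a b c => (X a b c : ℤ))
  have e1' : boxSum n w₀ (fun a b c => if b + c ≤ w₀ then get3 tX a b c * (X a (w₀ - b - c) c : ℤ) else 0) =
      boxSum n w₀ (fun a b c => if b + c ≤ w₀ then get3 tX a b c * (X a b c : ℤ) else 0) := by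
    unfold boxSum
    refine Finset.sum_congr rfl fun a _ => Finset.sum_congr rfl fun b _ => Finset.sum_congr rfl fun c _ => ?_
    beta_reduce
    split_ifs with hbc
    · rw [← hX a b c hbc]
    · rfl
  have key : boxSum n w₀ (fun a b c =>
      (if b + c ≤ w₀ then get3 tX a b c - get3 tX a (w₀ - b - c) c else 0) * (X a b c : ℤ)) =
      boxSum n w₀ (fun a b c => if b + c ≤ w₀ then get3 tX a b c * (X a b c : ℤ) else 0) -
        boxSum n w₀ (fun a b c => if b + c ≤ w₀ then get3 tX a (w₀ - b - c) c * (X a b c : ℤ) else 0) := by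
    unfold boxSum
    simp only [← Finset.sum_sub_distrib]
    refine Finset.sum_congr rfl fun a _ => Finset.sum_congr rfl fun b _ => Finset.sum_congr rfl fun c _ => ?_
    split_ifs <;> ring
  rw [key, ← e1, e1', sub_self]

/-- The `(A, B, W)` coefficient sums of a pair leaf, expanded into row contributions (pure algebra).
[cite: MacWilliamsSloane1977, Ch. 17 §4 Thm. 20] -/
theorem sum_coefABW_pair_expand (path : List RSplit) (L : RLeafP) (A B W : ℕ → ℕ) :
    ∑ j ∈ range (n + 1), (coefAG n k d e path L.G j * (A j : ℤ) + coefBG n k d e path L.G j * (B j : ℤ) +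
      coefWP n k d e path L j * (W j : ℤ)) =
      ∑ j ∈ range (n + 1), (combA (baseRows n k d e) L.G.base j * (A j : ℤ) + combB (baseRows n k d e) L.G.base j * B j +
        combW (baseRows n k d e) L.G.base j * W j) -
      ∑ j ∈ range (n + 1), L.G.lamR.getD j 0 * (A j : ℤ) - ∑ j ∈ range (n + 1), L.G.lamRp.getD j 0 * (B j : ℤ) -
      ∑ j ∈ range (n + 1), L.lamW.getD j 0 * (W j : ℤ) +
      ∑ j ∈ range (n + 1), (splitCoef path L.G.smult (fun s => s.ca.getD j 0) * A j +
        splitCoef path L.G.smult (fun s => s.cb.getD j 0) * B j +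
          splitCoef path L.G.smult (fun s => s.cw.getD j 0) * W j) := by
  simp only [coefWP, coefAG, coefBG, coefWG, ← Finset.sum_sub_distrib, ← Finset.sum_add_distrib]
  refine Finset.sum_congr rfl fun j _ => ?_
  ring

/-- The `(R, R′, R″)` coefficient box sum of a pair leaf, expanded into the thirteen row-family contributions (pure
algebra). [cite: MacWilliamsSloane1977, Ch. 17 §4 Thm. 20] -/
theorem boxSum_coefR_pair_expand (TP TT TP2 TT2 : List (List (List ℤ))) (path : List RSplit) (L : RLeafP)
    (R Rp Rpp : ℕ → ℕ → ℕ → ℕ) :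
    boxSum n w₀ (fun a b c => coefRP w₀ TT TT2 path L a b c * (R a b c : ℤ) +
      coefRpP n k w₀ TP path L a b c * (Rp a b c : ℤ) + coefRppP n k e w₀ TP2 L a b c * (Rpp a b c : ℤ)) =
      boxSum n w₀ (fun a b c => (if b + c ≤ w₀ then L.G.lamR.getD (a + b + c) 0 else 0) * (R a b c : ℤ)) +
      boxSum n w₀ (fun a b c => (if b + c ≤ w₀ then L.G.lamRp.getD (a + b + c) 0 else 0) * (Rp a b c : ℤ)) +
      boxSum n w₀ (fun a b c => (if b + c ≤ w₀ then L.lamW.getD (a + b + c) 0 else 0) * (Rpp a b c : ℤ)) +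
      boxSum n w₀ (fun a b c =>
        (if b + c ≤ w₀ then (2 : ℤ) ^ (n - k) * get3 TP a b c else 0) * Rp a b c +
          (if b + c ≤ w₀ then -get3 TT a b c else 0) * R a b c) +
      boxSum n w₀ (fun a b c =>
        (if b + c ≤ w₀ then (2 : ℤ) ^ (n - (k + e)) * get3 TP2 a b c else 0) * (Rpp a b c : ℤ) +
          (if b + c ≤ w₀ ∧ Even (a + b + c) then -get3 TT2 a b c else 0) * (R a b c : ℤ)) +
      boxSum n w₀ (fun a b c => (if Odd c ∨ w₀ < b + c then get3 L.G.zR a b c else 0) * (R a b c : ℤ) +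
        (if Odd c ∨ w₀ < b + c then get3 L.G.zRp a b c else 0) * (Rp a b c : ℤ)) +
      boxSum n w₀ (fun a b c =>
        (if Odd c ∨ w₀ < b + c then get3 L.zRpp a b c else 0) * (Rpp a b c : ℤ)) +
      boxSum n w₀ (fun a b c =>
        (if b + c ≤ w₀ then get3 L.G.tR a b c - get3 L.G.tR a (w₀ - b - c) c else 0) * (R a b c : ℤ)) +
      boxSum n w₀ (fun a b c =>
        (if b + c ≤ w₀ then get3 L.G.tRp a b c - get3 L.G.tRp a (w₀ - b - c) c else 0) * (Rp a b c : ℤ)) +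
      boxSum n w₀ (fun a b c =>
        (if b + c ≤ w₀ then get3 L.tRpp a b c - get3 L.tRpp a (w₀ - b - c) c else 0) * (Rpp a b c : ℤ)) +
      boxSum n w₀ (fun a b c => get3 L.G.kap a b c * ((Rp a b c : ℤ) - R a b c)) +
      boxSum n w₀ (fun a b c => get3 L.kap2 a b c * ((Rpp a b c : ℤ) - Rp a b c)) +
      boxSum n w₀ (fun a b c => (if a = 0 ∧ b = 0 ∧ c = 0 then L.G.zeta else 0) * (R a b c : ℤ) +
        (if a = 0 ∧ b = w₀ ∧ c = 0 then L.G.ups else 0) * (R a b c : ℤ)) +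
      boxSum n w₀ (fun a b c => splitCoef path L.G.smult (fun s => get3 s.cr a b c) * R a b c +
        splitCoef path L.G.smult (fun s => get3 s.crp a b c) * Rp a b c) := by
  simp only [← boxSum_add]
  unfold boxSum
  refine Finset.sum_congr rfl fun a _ => Finset.sum_congr rfl fun b _ => Finset.sum_congr rfl fun c _ => ?_
  beta_reduce
  simp only [coefRP, coefRpP, coefRppP, coefRG, coefRpG]
  split_ifs <;> ring

end RowAlgebra

end Summit.Ventures.QEC.Census
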